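import Literature.NumberTheory.EllipticCurves.HeegnerPointsKolyvaginVisibleDescentPairExactProofs
import HarnessLib

/-!
# The Cassels–Tate value formula for a VISIBLE PAIR, read member by member

Companion of `HeegnerPointsKolyvaginVisibleDescentPairExactProofs`
(`KolyvaginDescent.VisiblePairHypothesesM.sel₁_eq_and_card_sel₂_eq_of_primitive_of_torsion`: exactness for
a visible pair `(E, E^D)` over `ℚ` from the sum `prodPairing P₁ P₂` of two Cassels–Tate pairings). Its
value-formula hypothesis `hCTV` (McCallum 1991 Prop. 4.7 with Lemma 5.3 and Prop. 4.4 in order language,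
restricted to `p^{2M₀}`-torsion classes) is stated on `V₁ × V₂` for the pair class
`pairClass c₁ c₂ (ℓm)` and a pure class `t`. Since the class of even depth lives on the first member and
that of odd depth on the second, and the parts `V₁ × 0`, `0 × V₂` are orthogonal for `prodPairing`, the
hypothesis SPLITS into one value formula per member (`hCTV_of_members`):

* first member (`P₁` on `Sel₁`, classes `c₁` of EVEN depth `ℓm`, `m` of odd depth, the order condition
  at `λ` on `c₂(m)`);
* second member (`P₂` on `Sel₂`, classes `c₂` of ODD depth `ℓm`, `m` of even depth, the order condition at
  `λ` on `c₁(m)`).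

At `2` for the pair `(E, E^{(d_K)})` over `ℚ` these are the value formulas of the Cassels–Tate pairings of
`E/ℚ` and of `E^{(d_K)}/ℚ` separately. Pure bookkeeping (parity of the depth); no named fact; nothing here is
a claim about BSD.

## References

* W. G. McCallum, *Kolyvagin's work on Shafarevich–Tate groups*, LMS LNS 153 (1991), §2 (1), Prop. 4.7,
  Lemma 5.3, Thm. 5.4 (proof). [McCallumLMS1991]
* V. A. Kolyvagin, Izv. 1989, §3 (the pair `(E, E^D)` over `ℚ`, `l = 2`). [Kolyvagin1989Izv]
-/

open scoped Classical

namespace Literature.NumberTheory.EllipticCurves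

namespace KolyvaginDescent

namespace VisiblePairHypothesesM

variable {V₁ V₂ : Type*} [AddCommGroup V₁] [AddCommGroup V₂] {Pl : Type*}
variable {H : Type*} [AddCommGroup H] (S : VisiblePairHypothesesM V₁ V₂ Pl H)

/-! ### Plumbing (parity and the two parts, restated for this file) -/

/-- For `ℓm` a square-free product of Kolyvagin primes with `ℓ` one of them: `m` is such a product
and `r(ℓm) = r(m) + 1`. [cite: GrossLMS1991, §3 (3.1)–(3.2)] -/
private theorem kolSupp_of_mul'' {ℓ m : ℕ} (hℓ : S.Kol ℓ) (hn : KolSupp S.Kol (ℓ * m)) :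
    KolSupp S.Kol m ∧ m.primeFactors.card + 1 = (ℓ * m).primeFactors.card := by
  have hℓp := S.prime_of_kol ℓ hℓ
  have hmem : ℓ ∈ (ℓ * m).primeFactors :=
    Nat.mem_primeFactors.mpr ⟨hℓp, dvd_mul_right ℓ m, hn.ne_zero⟩
  obtain ⟨hsupp, -, -, -, -, -, -, hcard⟩ := kolSupp_div hn hmem
  rw [Nat.mul_div_cancel_left m hℓp.pos] at hsupp hcard
  exact ⟨hsupp, hcard⟩

/-- `v ∈ V^{(1)} ↔ v.2 = 0` for the parts of `toVisibleSplit`. [folklore] -/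
private theorem mem_part_one'' {v : V₁ × V₂} : v ∈ S.toVisibleSplit.part 1 ↔ v.2 = 0 := by
  change v ∈ pairEig V₁ V₂ 1 ↔ _
  simp [pairEig, AddSubgroup.mem_prod]

/-- `v ∈ V^{(-1)} ↔ v.1 = 0` for the parts of `toVisibleSplit`. [folklore] -/
private theorem mem_part_neg_one'' {v : V₁ × V₂} : v ∈ S.toVisibleSplit.part (-1) ↔ v.1 = 0 := by
  change v ∈ pairEig V₁ V₂ (-1) ↔ _
  simp [pairEig, AddSubgroup.mem_prod]

/-- The pair class at even depth is `(c₁ n, 0)`. [folklore] -/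
private theorem c_of_even {n : ℕ} (h : Even n.primeFactors.card) :
    S.toVisibleSplit.c n = (S.c₁ n, 0) := by
  change pairClass S.c₁ S.c₂ n = _
  simp [pairClass, h]

/-- The pair class at odd depth is `(0, c₂ n)`. [folklore] -/
private theorem c_of_odd {n : ℕ} (h : Odd n.primeFactors.card) :
    S.toVisibleSplit.c n = (0, S.c₂ n) := by
  have h' : ¬ Even n.primeFactors.card := Nat.not_even_iff_odd.mpr h
  change pairClass S.c₁ S.c₂ n = _
  simp [pairClass, h']

/-- Unfolding `prodPairing`. [cite: McCallumLMS1991, §2 (1)] -/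
private theorem prodPairing_apply' {R : Type*} [AddCommGroup R] (P₁ : S.Sel₁ →+ S.Sel₁ →+ R)
    (P₂ : S.Sel₂ →+ S.Sel₂ →+ R) (z t : S.toVisibleSplit.Sel) :
    S.prodPairing P₁ P₂ z t = P₁ (S.fstSel z) (S.fstSel t) + P₂ (S.sndSel z) (S.sndSel t) := rfl

/-! ### The value formula, member by member -/

/-- **The value formula of a visible pair SPLITS into the two members' value formulas.** If the
Cassels–Tate pairing `P₁` of the first member satisfies McCallum's value formula (Prop. 4.7 + Lemma 5.3
+ Prop. 4.4, order language, `p^{2M₀}`-torsion classes) for the classes `c₁` of even depth `ℓm` — the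
order condition at `λ` being on `c₂(m)` —, and `P₂` that of the second member for the classes `c₂` of odd
depth, then the sum pairing `prodPairing P₁ P₂` satisfies the pair value formula `hCTV` of
`sel₁_eq_and_card_sel₂_eq_of_primitive_of_torsion` (pure classes pair inside their own member).
[cite: McCallumLMS1991, §2 (1), Prop. 4.7, Lemma 5.3, Thm. 5.4 (proof)] [cite: Kolyvagin1989Izv, §3] -/
theorem hCTV_of_members {R : Type*} [AddCommGroup R] (P₁ : S.Sel₁ →+ S.Sel₁ →+ R)
    (P₂ : S.Sel₂ →+ S.Sel₂ →+ R)
    (hV₁ : ∀ ℓ m : ℕ, S.Kol ℓ → KolSupp S.Kol (ℓ * m) → ¬ ℓ ∣ m → Odd m.primeFactors.card →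
      ∀ (j N a b : ℕ) (t : V₁) (ht : t ∈ S.Sel₁) (hz : ((S.p : ℤ) ^ j) • S.c₁ (ℓ * m) ∈ S.Sel₁),
      ((S.p : ℤ) ^ N) • t = 0 → ((S.p : ℤ) ^ (2 * S.M₀)) • t = 0 →
      (∀ q ∈ m.primeFactors, t ∈ S.A₁ q) → S.M - S.M₀ ≤ j → N + S.M₀ ≤ S.M → N ≤ j →
      a + b + 1 = N → ((S.p : ℤ) ^ (a + (j - N))) • S.c₂ m ∉ S.A₂ ℓ →
      ((S.p : ℤ) ^ b) • t ∉ S.A₁ ℓ → P₁ ⟨_, hz⟩ ⟨t, ht⟩ ≠ 0)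
    (hV₂ : ∀ ℓ m : ℕ, S.Kol ℓ → KolSupp S.Kol (ℓ * m) → ¬ ℓ ∣ m → Even m.primeFactors.card →
      ∀ (j N a b : ℕ) (t : V₂) (ht : t ∈ S.Sel₂) (hz : ((S.p : ℤ) ^ j) • S.c₂ (ℓ * m) ∈ S.Sel₂),
      ((S.p : ℤ) ^ N) • t = 0 → ((S.p : ℤ) ^ (2 * S.M₀)) • t = 0 →
      (∀ q ∈ m.primeFactors, t ∈ S.A₂ q) → S.M - S.M₀ ≤ j → N + S.M₀ ≤ S.M → N ≤ j →
      a + b + 1 = N → ((S.p : ℤ) ^ (a + (j - N))) • S.c₁ m ∉ S.A₁ ℓ →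
      ((S.p : ℤ) ^ b) • t ∉ S.A₂ ℓ → P₂ ⟨_, hz⟩ ⟨t, ht⟩ ≠ 0) :
    ∀ ℓ m : ℕ, S.Kol ℓ → KolSupp S.Kol (ℓ * m) → ¬ ℓ ∣ m →
      ∀ (j N a b : ℕ) (t : V₁ × V₂) (ht : t ∈ S.toVisibleSplit.Sel)
        (hz : ((S.p : ℤ) ^ j) • S.toVisibleSplit.c (ℓ * m) ∈ S.toVisibleSplit.Sel),
      ((S.p : ℤ) ^ N) • t = 0 → ((S.p : ℤ) ^ (2 * S.M₀)) • t = 0 →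
      t ∈ S.toVisibleSplit.part (1 * (-1) ^ (ℓ * m).primeFactors.card) →
      (∀ q ∈ m.primeFactors, t ∈ S.toVisibleSplit.A q) → S.M - S.M₀ ≤ j → N + S.M₀ ≤ S.M → N ≤ j →
      a + b + 1 = N → ((S.p : ℤ) ^ (a + (j - N))) • S.toVisibleSplit.c m ∉ S.toVisibleSplit.A ℓ →
      ((S.p : ℤ) ^ b) • t ∉ S.toVisibleSplit.A ℓ →
      S.prodPairing P₁ P₂ ⟨_, hz⟩ ⟨t, ht⟩ ≠ 0 := by
  intro ℓ m hℓ hsupp hndvd j N a b t ht hz hN h2 hpart hAq hj hNM hNj hab hcm hbt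
  obtain ⟨-, hcard⟩ := S.kolSupp_of_mul'' hℓ hsupp
  have ht12 := AddSubgroup.mem_prod.mp ht
  rw [S.prodPairing_apply' P₁ P₂]
  rcases Nat.even_or_odd m.primeFactors.card with hev | hodd
  · -- `m` even, `ℓm` odd: the classes live on the second member
    have hodd' : Odd (ℓ * m).primeFactors.card := by rw [← hcard]; exact hev.add_one
    rw [hodd'.neg_one_pow, mul_neg_one] at hpart
    have ht1 : t.1 = 0 := S.mem_part_neg_one''.mp hpart
    have hcn := S.c_of_odd hodd'
    have hcm' := S.c_of_even hev
    have hz₂ : ((S.p : ℤ) ^ j) • S.c₂ (ℓ * m) ∈ S.Sel₂ := by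
      have h := (AddSubgroup.mem_prod.mp hz).2
      rwa [hcn, Prod.smul_snd] at h
    have hf : S.fstSel ⟨t, ht⟩ = 0 := Subtype.ext ht1
    have hs : S.sndSel ⟨_, hz⟩ = ⟨_, hz₂⟩ := Subtype.ext (by
      change (((S.p : ℤ) ^ j) • S.toVisibleSplit.c (ℓ * m)).2 = _
      rw [hcn, Prod.smul_snd])
    have hs' : S.sndSel ⟨t, ht⟩ = ⟨t.2, ht12.2⟩ := Subtype.ext rfl
    rw [hf, map_zero, zero_add, hs, hs']
    refine hV₂ ℓ m hℓ hsupp hndvd hev j N a b t.2 ht12.2 hz₂ (by simpa using congrArg Prod.snd hN)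
      (by simpa using congrArg Prod.snd h2) (fun q hq ↦ (AddSubgroup.mem_prod.mp (hAq q hq)).2) hj hNM
      hNj hab (fun h ↦ hcm ?_) (fun h ↦ hbt ?_)
    · rw [hcm']
      exact AddSubgroup.mem_prod.mpr ⟨by simpa using h, by simp⟩
    · refine AddSubgroup.mem_prod.mpr ⟨?_, by simpa using h⟩
      rw [Prod.smul_fst, ht1, smul_zero]
      exact zero_mem _
  · -- `m` odd, `ℓm` even: the classes live on the first member
    have hev' : Even (ℓ * m).primeFactors.card := by rw [← hcard]; exact hodd.add_one
    rw [hev'.neg_one_pow, mul_one] at hpart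
    have ht2 : t.2 = 0 := S.mem_part_one''.mp hpart
    have hcn := S.c_of_even hev'
    have hcm' := S.c_of_odd hodd
    have hz₁ : ((S.p : ℤ) ^ j) • S.c₁ (ℓ * m) ∈ S.Sel₁ := by
      have h := (AddSubgroup.mem_prod.mp hz).1
      rwa [hcn, Prod.smul_fst] at h
    have hsn : S.sndSel ⟨t, ht⟩ = 0 := Subtype.ext ht2
    have hfz : S.fstSel ⟨_, hz⟩ = ⟨_, hz₁⟩ := Subtype.ext (by
      change (((S.p : ℤ) ^ j) • S.toVisibleSplit.c (ℓ * m)).1 = _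
      rw [hcn, Prod.smul_fst])
    have hf' : S.fstSel ⟨t, ht⟩ = ⟨t.1, ht12.1⟩ := Subtype.ext rfl
    rw [hsn, map_zero, add_zero, hfz, hf']
    refine hV₁ ℓ m hℓ hsupp hndvd hodd j N a b t.1 ht12.1 hz₁ (by simpa using congrArg Prod.fst hN)
      (by simpa using congrArg Prod.fst h2) (fun q hq ↦ (AddSubgroup.mem_prod.mp (hAq q hq)).1) hj hNM
      hNj hab (fun h ↦ hcm ?_) (fun h ↦ hbt ?_)
    · rw [hcm']
      exact AddSubgroup.mem_prod.mpr ⟨by simp, by simpa using h⟩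
    · refine AddSubgroup.mem_prod.mpr ⟨by simpa using h, ?_⟩
      rw [Prod.smul_snd, ht2, smul_zero]
      exact zero_mem _

end VisiblePairHypothesesM

end KolyvaginDescent

end Literature.NumberTheory.EllipticCurves
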